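import Mathlib
import HarnessLib
import Summits.HodgeConjecture.HodgeConjecture.Theses.EightfoldTwistedSheafSeeds
import Summits.HodgeConjecture.HodgeConjecture.Theorems.EightfoldBlochSeedsBlochSpreadEightFourSpreadOfLiftedClassIntegralFibre
import Summits.HodgeConjecture.HodgeConjecture.Theorems.EightfoldBlochSeedsBlochSpreadEightFourCodimOfRegularImmersion
import Literature.AlgebraicGeometry.HodgeTheory.RegularImmersionIso
import Literature.AlgebraicGeometry.HodgeTheory.RegularImmersionConormal
import Literature.AlgebraicGeometry.HodgeTheory.ProperOverQuasiProjective

/-!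
# Crux `BlochSpreadEightFour` (stmt-HodgeConjecture-18884), line `bloch-lifts-fulton`: the crux BY NAME
# from Bloch's lifting fact and the weakest pivot `(LC′)` (lifting of supported classes)

HONEST FRAMING: short top-of-cone compositions (helper; no stub is closed; nothing here proves
`BlochSpreadEightFour` unconditionally, nor rung H2, HC_AV or HC). `BlochSpreadEightFour` BY NAME from the
named fact `Bloch1972_semiregularSubschemeLifts` (stub `stub_blochLifts`) and the LIFTING input of
`…SpreadOfLiftedClassIntegralFibre.lean`:

* `BlochSpreadEightFour_of_blochLifts_of_liftedClassNear` — input `(LC′)`: along a flat family with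
  INTEGRAL scheme-theoretic central fibre of codimension exactly `p`, every class supported on the central
  fibre is the restriction of a class with algebraic fibre restrictions near `v₀`. By the landed
  `liftedClassNear_of_relativeClassNearOfIntegralFibre` ∘ `relativeClassNearOfIntegralFibre_of_fulton`,
  the REGISTERED `fulton1998_flatFamily_cycleClass_specialises` implies `(LC′)` — a reshape
  `stub_fultonSpecialises ↦ (LC′)` is CONSERVATIVE — and `(LC′)` needs no non-vanishing / degree /
  Wirtinger input (the line owns the non-zero class `W|_{X₀}`).
* `BlochSpreadEightFour_of_blochLifts_of_liftedSupportedClass` — input the supported form `(LC)`.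

References: [Bloch1972Semiregularity] Thm. (7.1), (7.4), Remark (7.5); [Fulton1998] §10.1 Prop. 10.1 (a),
§19.1 eq. (1), Lemma 19.1.1, §19.2 Cor. 19.2 (b).
-/

-- every declaration of this problem lives in `Summit.HodgeConjecture.HodgeConjecture.…` (summit = sub-problem)
set_option linter.dupNamespace false

noncomputable section

open CategoryTheory CategoryTheory.Limits AlgebraicGeometry MonoidalCategory Order
open Literature.AlgebraicGeometry.Motives Literature.AlgebraicGeometry.HodgeTheory
open Literature.AlgebraicGeometry.Deformation
open Literature.AlgebraicTopology.SingularHomology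

namespace Summit.HodgeConjecture.HodgeConjecture.Theorems

/-- **The crux from Bloch's lifting fact and the weakest pivot `(LC′)`** — the line's composition
`BlochSpreadEightFour_of` with the Fulton stub replaced by the LIFTING statement `(LC′)`: transport the
seed along the chart `e : X₀ ≅ 𝒳_{s₀}` (`IsRegularImmersionOfCodim.comp_iso`, `IsBlochSemiregular.comp_iso`,
`coheight_left_base_eq_of_iso`), read the codimension-`4` generic point (landed
`stub_codimOfRegularImmersion`) and the support (landed `stub_supportAlongChart`) in the fibre, Hartshorne
projectivity of `f`, then `semiregularSpread_of_blochLifts_of_liftedClassNear`. Conditional on the two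
displayed hypotheses; the crux item is NOT closed by this theorem.
[cite: Bloch1972Semiregularity, Thm. (7.4) and Remark (7.5)] [cite: Fulton1998, §19.2 Cor. 19.2 (b)] -/
theorem BlochSpreadEightFour_of_blochLifts_of_liftedClassNear
    (hB : Bloch1972_semiregularSubschemeLifts)
    (hLC : ∀ ⦃n p : ℕ⦄ ⦃𝒳 V : SchemeOver ℂ⦄ (g : 𝒳 ⟶ V), 0 < p → IsSmoothProjectiveFamily g n →
      AlgebraicGeometry.Smooth V.hom →
      ∀ (𝒲 : Scheme) (ι : 𝒲 ⟶ 𝒳.left), IsClosedImmersion ι → Flat (ι ≫ g.left) →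
      ∀ (v₀ : ComplexPoints V), AlgebraicGeometry.IsIntegral (pullback ι (fiberι g v₀).left) →
      (∀ z : ↥(pullback ι (fiberι g v₀).left),
        (p : ℕ∞) ≤ Order.coheight ((pullback.snd ι (fiberι g v₀).left).base z)) →
      (∃ z : ↥(pullback ι (fiberι g v₀).left),
        Order.coheight ((pullback.snd ι (fiberι g v₀).left).base z) = (p : ℕ∞)) →
      ∀ y ∈ classesSupportedOn (fiberOver g v₀) (Set.range (pullback.snd ι (fiberι g v₀).left).base) (2 * p),
      ∃ (Γ : complexBetti 𝒳 (2 * p)) (U₁ : Set V.left), IsOpen U₁ ∧ v₀.pt ∈ U₁ ∧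
        (∀ t : ComplexPoints V, t.pt ∈ U₁ →
          complexBetti.map (fiberι g t) (2 * p) Γ ∈ algebraicClasses (fiberOver g t) p) ∧
        complexBetti.map (fiberι g v₀) (2 * p) Γ = y) :
    Summit.HodgeConjecture.HodgeConjecture.Theses.EightfoldTwistedSheafSeeds.BlochSpreadEightFour := by
  intro X₀ Z i x 𝒳 S f s₀ e W hi hreg hZ hcodim hsr hsupp hf h𝒳 hS hSm hW hx
  -- the central fibre is smooth projective, hence locally Noetherian; `Z` is integral
  haveI : IsLocallyNoetherian (fiberOver f s₀).left :=
    IsSmoothProjective.isLocallyNoetherian_holds (hf.isSmoothProjective s₀)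
  haveI := hZ
  -- transport the seed along the chart `e : X₀ ≅ 𝒳_{s₀}`
  have hreg' : IsRegularImmersionOfCodim (i ≫ e.hom.left) 4 := hreg.comp_iso (leftIso e)
  haveI : IsClosedImmersion (i ≫ e.hom.left) := hreg'.isClosedImmersion
  have hlci : IsFiniteLocallyFree (conormalSheaf (i ≫ e.hom.left)) :=
    hreg'.isFiniteLocallyFree_conormalSheaf
  have hsr' : IsBlochSemiregular (i ≫ e.hom.left) (2 * 4) 4 := IsBlochSemiregular.comp_iso e i hsr
  have hcoh : ∀ z : Z, ((4 : ℕ) : ℕ∞) ≤ Order.coheight ((i ≫ e.hom.left).base z) := by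
    intro z
    have h1 : (i ≫ e.hom.left).base z = e.hom.left.base (i.base z) := rfl
    rw [h1, coheight_left_base_eq_of_iso e (i.base z)]
    exact hcodim _ ⟨z, rfl⟩
  have hcohp : ∃ z : Z, Order.coheight ((i ≫ e.hom.left).base z) = ((4 : ℕ) : ℕ∞) :=
    stub_codimOfRegularImmersion (i ≫ e.hom.left) 4 hreg'
  -- Hartshorne projectivity of `f`
  have hproj :=
    IsQuasiProjectiveOver.exists_isClosedImmersion_projectiveSpace_tensor_of_isSmoothProjectiveFamily f hf h𝒳
  -- the support of `W|_{X₀}` read in the fibre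
  have hsupp' : complexBetti.map (fiberι f s₀) (2 * 4) W ∈
      classesSupportedOn (fiberOver f s₀) (Set.range (i ≫ e.hom.left).base) (2 * 4) :=
    stub_supportAlongChart e i (2 * 4) _ (hx ▸ hsupp)
  exact semiregularSpread_of_blochLifts_of_liftedClassNear hB hLC f (2 * 4) 4 hf hproj
    hSm s₀ Z (i ≫ e.hom.left) inferInstance hlci hZ hcoh hcohp hsr' W (fun s => (hW s).2) hsupp'

/-- **The crux from Bloch's lifting fact and the supported lifting statement `(LC)`** (every class
supported on the integral central fibre of the flat family is the restriction of a class SUPPORTED on the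
family): through `(LC) ⟹ (LC′)`. Conditional on the two displayed hypotheses; the crux item is NOT closed
by this theorem. [cite: Bloch1972Semiregularity, Thm. (7.4) and Remark (7.5)] [cite: Fulton1998, §19.1 eq. (1)] -/
theorem BlochSpreadEightFour_of_blochLifts_of_liftedSupportedClass
    (hB : Bloch1972_semiregularSubschemeLifts)
    (hLC : ∀ ⦃n p : ℕ⦄ ⦃𝒳 V : SchemeOver ℂ⦄ (g : 𝒳 ⟶ V), 0 < p → IsSmoothProjectiveFamily g n →
      AlgebraicGeometry.Smooth V.hom →
      ∀ (𝒲 : Scheme) (ι : 𝒲 ⟶ 𝒳.left), IsClosedImmersion ι → Flat (ι ≫ g.left) →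
      ∀ (v₀ : ComplexPoints V), AlgebraicGeometry.IsIntegral (pullback ι (fiberι g v₀).left) →
      (∀ z : ↥(pullback ι (fiberι g v₀).left),
        (p : ℕ∞) ≤ Order.coheight ((pullback.snd ι (fiberι g v₀).left).base z)) →
      (∃ z : ↥(pullback ι (fiberι g v₀).left),
        Order.coheight ((pullback.snd ι (fiberι g v₀).left).base z) = (p : ℕ∞)) →
      ∀ y ∈ classesSupportedOn (fiberOver g v₀) (Set.range (pullback.snd ι (fiberι g v₀).left).base) (2 * p),
      ∃ Γ : complexBetti 𝒳 (2 * p),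
        Γ ∈ classesSupportedOn 𝒳 (Set.range ι.base) (2 * p) ∧
        complexBetti.map (fiberι g v₀) (2 * p) Γ = y) :
    Summit.HodgeConjecture.HodgeConjecture.Theses.EightfoldTwistedSheafSeeds.BlochSpreadEightFour :=
  BlochSpreadEightFour_of_blochLifts_of_liftedClassNear hB (liftedClassNear_of_liftedSupportedClass hLC)

end Summit.HodgeConjecture.HodgeConjecture.Theorems

end
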